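import Mathlib
import Summits.ValiantsHypothesis.ValiantsHypothesis.Theorems.NewtonUnitEquationsTwoProductsPlanarCellRelationClassesPrelim
import HarnessLib

/-!
# Crux `TwoProducts` (stmt-ValiantsHypothesis-5906): the FEW-RELATION-CLASSES law (t-free)
# (`r` primitive relation classes ⇒ per cell `#S ≤ 2(m+1)·(3(2+m+C(m,2))²)^r`)

Helper mode (`--supports stmt-ValiantsHypothesis-5906 --as helper`; val-lit-p3 g14, KEEP lineage).  Generalises rung R1 of
`Cruxes/TwoProducts/Lines/relation_ladder.lean` (val-idea-8 g2; landed as `singleRelationLaw`, `singleRelationLaw_tfree`) from ONE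
relation class to `r` classes `(Jc k, ac k, bc k)`, `k : Fin r`, with ARBITRARY (possibly overlapping) supports: if every additive
coincidence of letter tuples of `∏_j (A_j ∪ {0})` is one of them — two distinct tuples with the same point differ exactly on some
`Jc k` and carry `(ac k, bc k)` or `(bc k, ac k)` there — then every weight-order cell family has
`#S ≤ 2(m+1)·(3·(2+m+C(m,2))²)^r` (`planarCell_relationClasses`), with NO dependence on the sparsity.  `r = 0` is the dissociated
regime (`2(m+1)`, p603804), `r = 1` the single-relation law.

PROOF.  Key of a visible point (through its representation `c`, chosen with `F(c) ≠ G(c)`): for each class `k`, the TAG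
(`c|Jc k = ac k` / `= bc k` / lone) and the two letter-free difference keys `κ_{ac k}, κ_{bc k}` of `c` on `Jc k`
(`κ_x = D_x` if `#D_x ≤ 2`, else `Jc k`).  Inside one key class: all representations carry the same letters on the merged block
union `B = ⋃_{tag ≠ lone} Jc k`; a one/two-letter upgrade by class members keeps `B` and stays lone for every lone class
(`not_Jpart_of_keyEq`), so every tuple with its point differs from it only inside `B`; by FIBRE TRANSPORT
(`exists_coeff_tailDiff_of_Bagree`) the coefficients of all these tuples are `cF·F_offB − cG·G_offB` with CLASS CONSTANTS, and
`card_family_le_of_coeff` gives `≤ 2(m+1)` per key class; there are at most `(3·(2+m+C(m,2))²)^r` keys.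

Reading (census axis for the residual): the `t`-dependence of `PlanarCellBound` is carried by the NUMBER of relation classes — a
bounded number of classes, of any support sizes and with all their translates, is `t`-free `poly(m)`; the `m = 2` staircase
(`not_planarSlotBound`, p600147) has `Θ(K²)` classes for `K+1` visible points, where the per-class cost is `o(1)` and the right
currency is T3/P2's `√coin`.
Honest framing: a helper law outside any cone of the OPEN crux line; the residual, `PlanarCellBound`, the crux `TwoProducts` and
`VP ≠ VNP` are OPEN and NOT claimed; no summit statement is proved here.  No instances, no notation, no named facts. [folklore]
-/

noncomputable section

-- Sub = Summit single-conjunct layout: the duplicated namespace component is mandated by the tree.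
set_option linter.dupNamespace false

open scoped BigOperators
open MvPolynomial
open Summit.ValiantsHypothesis.ValiantsHypothesis.Theorems.NewtonUnitEquations.TwoProducts.FormalLogLinearisation

namespace Summit.ValiantsHypothesis.ValiantsHypothesis.Theorems.NewtonUnitEquations.TwoProducts.PlanarCell

variable {m : ℕ}

/-- Counting keys: `#∏_k ({0,1,2} × Keys_k × Keys_k) ≤ (3·(2+m+C(m,2))²)^r`. [folklore] -/
theorem card_classKeys_le {r : ℕ} (Jc : Fin r → Finset (Fin m)) :
    (Fintype.piFinset fun k : Fin r => (Finset.range 3) ×ˢ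
        ((insert (Jc k) ((Jc k).powerset.filter fun D => D.card ≤ 2)) ×ˢ
          (insert (Jc k) ((Jc k).powerset.filter fun D => D.card ≤ 2)))).card ≤
      (3 * (2 + m + m.choose 2) ^ 2) ^ r := by
  classical
  rw [Fintype.card_piFinset]
  have hk : ∀ k : Fin r, ((Finset.range 3) ×ˢ
      ((insert (Jc k) ((Jc k).powerset.filter fun D => D.card ≤ 2)) ×ˢ
        (insert (Jc k) ((Jc k).powerset.filter fun D => D.card ≤ 2)))).card ≤ 3 * (2 + m + m.choose 2) ^ 2 := by
    intro k
    rw [Finset.card_product, Finset.card_product, Finset.card_range]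
    have h := card_JpartKeySet_le (m := m) (Jc k)
    calc 3 * ((insert (Jc k) ((Jc k).powerset.filter fun D => D.card ≤ 2)).card *
          (insert (Jc k) ((Jc k).powerset.filter fun D => D.card ≤ 2)).card)
        ≤ 3 * ((2 + m + m.choose 2) * (2 + m + m.choose 2)) := Nat.mul_le_mul_left 3 (Nat.mul_le_mul h h)
      _ = 3 * (2 + m + m.choose 2) ^ 2 := by ring
  calc ∏ k, ((Finset.range 3) ×ˢ ((insert (Jc k) ((Jc k).powerset.filter fun D => D.card ≤ 2)) ×ˢ
          (insert (Jc k) ((Jc k).powerset.filter fun D => D.card ≤ 2)))).card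
      ≤ (3 * (2 + m + m.choose 2) ^ 2) ^ (Finset.univ : Finset (Fin r)).card :=
        Finset.prod_le_pow_card _ _ _ fun k _ => hk k
    _ = (3 * (2 + m + m.choose 2) ^ 2) ^ r := by rw [Finset.card_univ, Fintype.card_fin]

/-- **THE FEW-RELATION-CLASSES LAW (t-free).**  Tails `u_j, v_j` supported in `A_j ∌ 0` (no bound on `#A_j` is used); `r` relation
classes `(Jc k, ac k, bc k)` such that any two distinct letter tuples of `∏_j (A_j ∪ {0})` with the same point differ exactly on
some `Jc k` and carry `(ac k, bc k)` or `(bc k, ac k)` there.  Then every weight-order cell family `S` of log-visible points has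
`#S ≤ 2(m+1)·(3·(2+m+C(m,2))²)^r`. [folklore] -/
theorem planarCell_relationClasses (u v : Fin m → MvPolynomial (Fin 2) ℂ) (A : Fin m → Finset Expo)
    (hA0 : ∀ j, (0 : Expo) ∉ A j) (huA : ∀ j, (u j).support ⊆ A j) (hvA : ∀ j, (v j).support ⊆ A j)
    {r : ℕ} (Jc : Fin r → Finset (Fin m)) (ac bc : Fin r → Fin m → Expo)
    (hSR : ∀ a ∈ tuples A, ∀ b ∈ tuples A, a ≠ b → ∑ j, a j = ∑ j, b j →
      ∃ k : Fin r, (∀ j, a j ≠ b j ↔ j ∈ Jc k) ∧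
        ((∀ j ∈ Jc k, a j = ac k j ∧ b j = bc k j) ∨ (∀ j ∈ Jc k, a j = bc k j ∧ b j = ac k j)))
    (R : Expo → Expo → Prop) (S : Finset Expo) (hS : IsCellFamily u v R S) :
    S.card ≤ 2 * (m + 1) * (3 * (2 + m + m.choose 2) ^ 2) ^ r := by
  classical
  set PF := tuples A with hPF
  set T := tailSupport u v with hT
  have hu0 : ∀ j, coeff 0 (u j) = 0 := fun j => notMem_support_iff.1 fun h => hA0 j (huA j h)
  have hv0 : ∀ j, coeff 0 (v j) = 0 := fun j => notMem_support_iff.1 fun h => hA0 j (hvA j h)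
  rcases S.eq_empty_or_nonempty with hS0 | ⟨l₀, hl₀⟩
  · simp [hS0]
  obtain ⟨ζ, hζval, -, hRζ⟩ := hS l₀ hl₀
  -- representations with `F ≠ G`
  have hrep : ∀ l ∈ S, ∃ a ∈ PF, ∑ j, a j = l ∧
      ∏ j, hatCoeff (u j) (a j) ≠ ∏ j, hatCoeff (v j) (a j) := by
    intro l hl
    obtain ⟨ξ, hval, htop, -⟩ := hS l hl
    have hmem : l ∈ (tailDiff u v).support := ((stub_logLinearisation m u v hu0 hv0 ξ hval l).2 htop).1
    have hne : coeff l (tailDiff u v) ≠ 0 := mem_support_iff.1 hmem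
    have hW : tailDiff u v = ∏ j, (1 + u j) - ∏ j, (1 + v j) := rfl
    rw [hW, coeff_sub, coeff_prod_one_add_eq_fibreSum u A hA0 huA, coeff_prod_one_add_eq_fibreSum v A hA0 hvA,
      ← Finset.sum_sub_distrib] at hne
    obtain ⟨a, ha, hne'⟩ := Finset.exists_ne_zero_of_sum_ne_zero hne
    rw [Finset.mem_filter] at ha
    exact ⟨a, ha.1, ha.2, fun h => hne' (sub_eq_zero.2 h)⟩
  choose! rep hrepPF hrepsum hrepne using hrep
  -- letters of representations are `0` or tail exponents
  have hT_of : ∀ (w : Fin m → MvPolynomial (Fin 2) ℂ) (i : Fin m) (e : Expo), (w = u ∨ w = v) →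
      hatCoeff (w i) e ≠ 0 → e = 0 ∨ e ∈ T := by
    intro w i e hw hne
    by_cases he : e = 0
    · exact Or.inl he
    · right
      simp only [hatCoeff, he, if_false] at hne
      have hmem : e ∈ (w i).support := mem_support_iff.2 hne
      rcases hw with rfl | rfl
      · exact Finset.mem_union_left _ (Finset.mem_biUnion.2 ⟨i, Finset.mem_univ _, hmem⟩)
      · exact Finset.mem_union_right _ (Finset.mem_biUnion.2 ⟨i, Finset.mem_univ _, hmem⟩)
  have hrepT : ∀ l ∈ S, ∀ i, rep l i = 0 ∨ rep l i ∈ T := by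
    intro l hl i
    by_cases hF : ∏ j, hatCoeff (u j) (rep l j) = 0
    · have hG : ∏ j, hatCoeff (v j) (rep l j) ≠ 0 := fun hG => hrepne l hl (by rw [hF, hG])
      exact hT_of v i _ (Or.inr rfl) (Finset.prod_ne_zero_iff.1 hG i (Finset.mem_univ _))
    · exact hT_of u i _ (Or.inl rfl) (Finset.prod_ne_zero_iff.1 hF i (Finset.mem_univ _))
  -- shapes of upgrades (including the trivial one `y = rep l`)
  have hshape : ∀ (l l₁ l₂ : Expo) (j j' : Fin m) (a' : Fin m → Expo),
      (a' = rep l ∨ a' = Function.update (rep l) j (rep l₁ j) ∨ a' = Function.update (rep l) j' (rep l₂ j') ∨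
          a' = Function.update (Function.update (rep l) j (rep l₁ j)) j' (rep l₂ j')) →
      (∀ i, a' i = rep l i ∨ a' i = rep l₁ i ∨ a' i = rep l₂ i) ∧ (∀ i, i ≠ j → i ≠ j' → a' i = rep l i) := by
    intro l l₁ l₂ j j' a' ha'
    rcases ha' with rfl | rfl | rfl | rfl
    · exact ⟨fun i => Or.inl rfl, fun i _ _ => rfl⟩
    · refine ⟨fun i => ?_, fun i hij _ => by rw [Function.update_of_ne hij]⟩
      by_cases hi : i = j
      · subst hi; rw [Function.update_self]; exact Or.inr (Or.inl rfl)
      · rw [Function.update_of_ne hi]; exact Or.inl rfl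
    · refine ⟨fun i => ?_, fun i _ hij' => by rw [Function.update_of_ne hij']⟩
      by_cases hi : i = j'
      · subst hi; rw [Function.update_self]; exact Or.inr (Or.inr rfl)
      · rw [Function.update_of_ne hi]; exact Or.inl rfl
    · refine ⟨fun i => ?_, fun i hij hij' => by rw [Function.update_of_ne hij', Function.update_of_ne hij]⟩
      by_cases hi : i = j'
      · subst hi; rw [Function.update_self]; exact Or.inr (Or.inr rfl)
      · rw [Function.update_of_ne hi]
        by_cases hi2 : i = j
        · subst hi2; rw [Function.update_self]; exact Or.inr (Or.inl rfl)
        · rw [Function.update_of_ne hi2]; exact Or.inl rfl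
  have hlettersPF : ∀ l ∈ S, ∀ l₁ ∈ S, ∀ l₂ ∈ S, ∀ a' : Fin m → Expo,
      (∀ i, a' i = rep l i ∨ a' i = rep l₁ i ∨ a' i = rep l₂ i) → a' ∈ PF := by
    intro l hl l₁ hl₁ l₂ hl₂ a' hletters
    have m0 := Fintype.mem_piFinset.1 (hrepPF l hl)
    have m1 := Fintype.mem_piFinset.1 (hrepPF l₁ hl₁)
    have m2 := Fintype.mem_piFinset.1 (hrepPF l₂ hl₂)
    refine Fintype.mem_piFinset.2 fun i => ?_
    rcases hletters i with h | h | h <;> rw [h]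
    · exact m0 i
    · exact m1 i
    · exact m2 i
  -- the key
  let tag : (Fin m → Expo) → Fin r → ℕ := fun c k =>
    if (∀ i ∈ Jc k, c i = ac k i) then 0 else if (∀ i ∈ Jc k, c i = bc k i) then 1 else 2
  let kap : (Fin m → Expo) → Finset (Fin m) → (Fin m → Expo) → Finset (Fin m) := fun x J c =>
    if (J.filter fun i => c i ≠ x i).card ≤ 2 then (J.filter fun i => c i ≠ x i) else J
  let key : Expo → (Fin r → ℕ × (Finset (Fin m) × Finset (Fin m))) := fun l k =>
    (tag (rep l) k, (kap (ac k) (Jc k) (rep l), kap (bc k) (Jc k) (rep l)))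
  have htag0 : ∀ c k, tag c k = 0 → ∀ i ∈ Jc k, c i = ac k i := by
    intro c k h
    by_cases h1 : ∀ i ∈ Jc k, c i = ac k i
    · exact h1
    · exfalso
      by_cases h2 : ∀ i ∈ Jc k, c i = bc k i
      · simp only [tag, if_neg h1, if_pos h2] at h; omega
      · simp only [tag, if_neg h1, if_neg h2] at h; omega
  have htag1 : ∀ c k, tag c k = 1 → ∀ i ∈ Jc k, c i = bc k i := by
    intro c k h
    by_cases h1 : ∀ i ∈ Jc k, c i = ac k i
    · exfalso; simp only [tag, if_pos h1] at h; omega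
    · by_cases h2 : ∀ i ∈ Jc k, c i = bc k i
      · exact h2
      · exfalso; simp only [tag, if_neg h1, if_neg h2] at h; omega
  have htag2 : ∀ c k, tag c k ≠ 0 → tag c k ≠ 1 → (¬ ∀ i ∈ Jc k, c i = ac k i) ∧ (¬ ∀ i ∈ Jc k, c i = bc k i) := by
    intro c k h0 h1
    by_cases ha : ∀ i ∈ Jc k, c i = ac k i
    · exfalso; apply h0; simp only [tag, if_pos ha]
    · by_cases hb : ∀ i ∈ Jc k, c i = bc k i
      · exfalso; apply h1; simp only [tag, if_neg ha, if_pos hb]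
      · exact ⟨ha, hb⟩
  have htaglt : ∀ c k, tag c k < 3 := by
    intro c k
    simp only [tag]
    split_ifs <;> omega
  -- one key class has at most `2(m+1)` points
  have hgroup : ∀ K : Fin r → ℕ × (Finset (Fin m) × Finset (Fin m)),
      (S.filter fun l => key l = K).card ≤ 2 * (m + 1) := by
    intro K
    set G := S.filter fun l => key l = K with hG
    have hGS : ∀ l ∈ G, l ∈ S := fun l hl => (Finset.mem_filter.1 hl).1
    have hGK : ∀ l ∈ G, key l = K := fun l hl => (Finset.mem_filter.1 hl).2
    rcases G.eq_empty_or_nonempty with hG0 | ⟨lstar, hlstar⟩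
    · rw [hG0, Finset.card_empty]; exact Nat.zero_le _
    -- the merged block union of the class
    set B := (Finset.univ.filter fun k : Fin r => (K k).1 ≠ 2).biUnion Jc with hB
    -- tags of members
    have htagK : ∀ l ∈ G, ∀ k, tag (rep l) k = (K k).1 := fun l hl k => by
      have := congrFun (hGK l hl) k
      exact congrArg Prod.fst this
    have hkapA : ∀ l ∈ G, ∀ k, kap (ac k) (Jc k) (rep l) = (K k).2.1 := fun l hl k => by
      have := congrFun (hGK l hl) k
      exact congrArg Prod.fst (congrArg Prod.snd this)
    have hkapB : ∀ l ∈ G, ∀ k, kap (bc k) (Jc k) (rep l) = (K k).2.2 := fun l hl k => by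
      have := congrFun (hGK l hl) k
      exact congrArg Prod.snd (congrArg Prod.snd this)
    -- letters on the block are common to the class
    have hBletter : ∀ l ∈ G, ∀ l' ∈ G, ∀ i ∈ B, rep l i = rep l' i := by
      intro l hl l' hl' i hi
      rw [hB, Finset.mem_biUnion] at hi
      obtain ⟨k, hk, hik⟩ := hi
      have hk2 : (K k).1 ≠ 2 := (Finset.mem_filter.1 hk).2
      have ht := htagK l hl k
      have ht' := htagK l' hl' k
      have hlt := htaglt (rep l) k
      by_cases h0 : (K k).1 = 0
      · rw [htag0 (rep l) k (ht.trans h0) i hik, htag0 (rep l') k (ht'.trans h0) i hik]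
      · have h1 : (K k).1 = 1 := by omega
        rw [htag1 (rep l) k (ht.trans h1) i hik, htag1 (rep l') k (ht'.trans h1) i hik]
    -- the core: tuples built from class members agree with the base on `B` and have all their point-mates inside `B`
    have hcore : ∀ l ∈ G, ∀ l₁ ∈ G, ∀ l₂ ∈ G, ∀ (j j' : Fin m) (y : Fin m → Expo),
        (∀ i, y i = rep l i ∨ y i = rep l₁ i ∨ y i = rep l₂ i) → (∀ i, i ≠ j → i ≠ j' → y i = rep l i) →
        y ∈ PF ∧ (∀ i ∈ B, y i = rep lstar i) ∧
          (∀ b ∈ PF, ∑ i, b i = ∑ i, y i → ∀ i, i ∉ B → b i = y i) := by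
      intro l hl l₁ hl₁ l₂ hl₂ j j' y hletters hagree
      have hyPF : y ∈ PF := hlettersPF l (hGS l hl) l₁ (hGS l₁ hl₁) l₂ (hGS l₂ hl₂) y hletters
      refine ⟨hyPF, ?_, ?_⟩
      · intro i hi
        rcases hletters i with h | h | h <;> rw [h]
        · exact hBletter l hl lstar hlstar i hi
        · exact hBletter l₁ hl₁ lstar hlstar i hi
        · exact hBletter l₂ hl₂ lstar hlstar i hi
      · intro b hb hsum i hiB
        by_cases hby : b = y
        · rw [hby]
        obtain ⟨k, hiff, hcase⟩ := hSR y hyPF b hb (Ne.symm hby) hsum.symm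
        -- the class `k` is merged for the key class: otherwise `y` would be lone for it
        have hk2 : (K k).1 ≠ 2 := by
          intro hK2
          have hl2 := htag2 (rep l) k (by rw [htagK l hl k]; omega) (by rw [htagK l hl k]; omega)
          have hkA : kap (ac k) (Jc k) (rep l₁) = kap (ac k) (Jc k) (rep l) := by rw [hkapA l₁ hl₁ k, hkapA l hl k]
          have hkA' : kap (ac k) (Jc k) (rep l₂) = kap (ac k) (Jc k) (rep l) := by rw [hkapA l₂ hl₂ k, hkapA l hl k]
          have hkB : kap (bc k) (Jc k) (rep l₁) = kap (bc k) (Jc k) (rep l) := by rw [hkapB l₁ hl₁ k, hkapB l hl k]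
          have hkB' : kap (bc k) (Jc k) (rep l₂) = kap (bc k) (Jc k) (rep l) := by rw [hkapB l₂ hl₂ k, hkapB l hl k]
          have hna := not_Jpart_of_keyEq (Jc k) (ac k) (rep l) (rep l₁) (rep l₂) y j j' hl2.1 hkA hkA' hletters hagree
          have hnb := not_Jpart_of_keyEq (Jc k) (bc k) (rep l) (rep l₁) (rep l₂) y j j' hl2.2 hkB hkB' hletters hagree
          rcases hcase with h | h
          · exact hna fun i hi => (h i hi).1
          · exact hnb fun i hi => (h i hi).1
        have hJB : Jc k ⊆ B := by
          intro i' hi'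
          rw [hB, Finset.mem_biUnion]
          exact ⟨k, Finset.mem_filter.2 ⟨Finset.mem_univ _, hk2⟩, hi'⟩
        have hiJ : i ∉ Jc k := fun h => hiB (hJB h)
        by_contra hne
        exact hiJ ((hiff i).1 (Ne.symm hne))
    -- member representations: point-mates inside `B`
    have hbase : ∀ l ∈ G, ∀ b ∈ PF, ∑ i, b i = ∑ i, rep l i → ∀ i, i ∉ B → b i = rep l i := by
      intro l hl b hb hsum i hiB
      by_cases hby : b = rep l
      · rw [hby]
      obtain ⟨k, hiff, hcase⟩ := hSR (rep l) (hrepPF l (hGS l hl)) b hb (Ne.symm hby) hsum.symm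
      have hk2 : (K k).1 ≠ 2 := by
        intro hK2
        have hl2 := htag2 (rep l) k (by rw [htagK l hl k]; omega) (by rw [htagK l hl k]; omega)
        rcases hcase with h | h
        · exact hl2.1 fun i hi => (h i hi).1
        · exact hl2.2 fun i hi => (h i hi).1
      have hJB : Jc k ⊆ B := by
        intro i' hi'
        rw [hB, Finset.mem_biUnion]
        exact ⟨k, Finset.mem_filter.2 ⟨Finset.mem_univ _, hk2⟩, hi'⟩
      have hiJ : i ∉ Jc k := fun h => hiB (hJB h)
      by_contra hne
      exact hiJ ((hiff i).1 (Ne.symm hne))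
    -- constants from the base member, then the family bound
    obtain ⟨cF, cG, hcoef⟩ :=
      exists_coeff_tailDiff_of_Bagree u v A hA0 huA hvA B (hrepPF lstar (hGS lstar hlstar)) (hbase lstar hlstar)
    refine card_family_le_of_coeff u v A hA0 huA hvA R S hS ζ hζval hRζ rep hrepsum hrepT G
      (fun _ hl => (Finset.mem_filter.1 hl).1) B cF cG ?_ ?_
    · intro l hl
      exact hcoef (rep l) (hrepPF l (hGS l hl)) (fun i hi => hBletter l hl lstar hlstar i hi) (hbase l hl)
    · intro l hl l₁ hl₁ l₂ hl₂ j j' y hy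
      obtain ⟨hsh1, hsh2⟩ := hshape l l₁ l₂ j j' y (Or.inr hy)
      obtain ⟨hyPF, hyB, Hy⟩ := hcore l hl l₁ hl₁ l₂ hl₂ j j' y hsh1 hsh2
      exact hcoef y hyPF hyB Hy
  -- counting the keys
  set KeySet := Fintype.piFinset fun k : Fin r => (Finset.range 3) ×ˢ
      ((insert (Jc k) ((Jc k).powerset.filter fun D => D.card ≤ 2)) ×ˢ
        (insert (Jc k) ((Jc k).powerset.filter fun D => D.card ≤ 2))) with hKeySet
  have hkapmem : ∀ (x : Fin m → Expo) (J : Finset (Fin m)) (c : Fin m → Expo),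
      kap x J c ∈ insert J (J.powerset.filter fun D => D.card ≤ 2) := by
    intro x J c
    simp only [kap]
    split_ifs with h
    · exact Finset.mem_insert_of_mem (Finset.mem_filter.2 ⟨Finset.mem_powerset.2 (Finset.filter_subset _ _), h⟩)
    · exact Finset.mem_insert_self _ _
  have himage : S.image key ⊆ KeySet := by
    intro K hK
    obtain ⟨l, -, rfl⟩ := Finset.mem_image.1 hK
    rw [hKeySet, Fintype.mem_piFinset]
    intro k
    exact Finset.mem_product.2 ⟨Finset.mem_range.2 (htaglt (rep l) k),
      Finset.mem_product.2 ⟨hkapmem _ _ _, hkapmem _ _ _⟩⟩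
  have hKeycard : KeySet.card ≤ (3 * (2 + m + m.choose 2) ^ 2) ^ r := card_classKeys_le Jc
  calc S.card = ∑ K ∈ S.image key, (S.filter fun l => key l = K).card := Finset.card_eq_sum_card_image key S
    _ ≤ ∑ _K ∈ S.image key, 2 * (m + 1) := Finset.sum_le_sum fun K _ => hgroup K
    _ = (S.image key).card * (2 * (m + 1)) := by rw [Finset.sum_const, smul_eq_mul]
    _ ≤ KeySet.card * (2 * (m + 1)) := Nat.mul_le_mul_right _ (Finset.card_le_card himage)
    _ ≤ (3 * (2 + m + m.choose 2) ^ 2) ^ r * (2 * (m + 1)) := Nat.mul_le_mul_right _ hKeycard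
    _ = 2 * (m + 1) * (3 * (2 + m + m.choose 2) ^ 2) ^ r := by ring

end Summit.ValiantsHypothesis.ValiantsHypothesis.Theorems.NewtonUnitEquations.TwoProducts.PlanarCell

end
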